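import Summits.FinalStateConjecture.FinalStateConjecture.Theorems.EIHFluxBalanceInertialRecessionStubEndgameBasics

/-!
# Route EIHFluxBalance — crux `InertialRecession`, abstract endgame for GENERAL `N`:
# the relativistic virial coercivity and the reduction of the pairwise dichotomy to velocity convergence

Helper file for the crux `stmt-FinalStateConjecture-10166`
(`Summit.FinalStateConjecture.FinalStateConjecture.Theses.EIHFluxBalance.InertialRecession`), line
`sublinear-is-free-clean-window-charges`, stub `stub_pairwiseDichotomy` (open for `N ≥ 3`), and line
`old-light-leaves-the-cone`, stub `stub_expandingChargeKinematics` (same difficulty).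

WHAT IS HERE (Mathlib-only real analysis / algebra, every `N`).

1. `inner_lorentzMomentum_sub_ge` — STRONG MONOTONICITY OF THE RELATIVISTIC MOMENTUM MAP `v ↦ γ(v)v`,
   `γ(v) = (1 − ‖v‖²)^{-1/2}`, on the open unit ball: `‖a − b‖² ≤ ⟨γ(a)a − γ(b)b, a − b⟩`. (It is the gradient of
   the uniformly convex function `−√(1 − ‖v‖²)`; the proof given is elementary: the excess momentum
   `x ↦ x(γ(x) − 1)` is monotone.)
2. `virial_coercivity` / `virial_coercivity_mean` — THE REST-MASS VIRIAL IS COERCIVE: for masses `Mⱼ ≥ 0` and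
   subluminal velocities, `Σⱼ Mⱼ ⟨γⱼvⱼ, vⱼ − U⟩ ≥ (2ΣM)⁻¹ Σⱼₖ MⱼMₖ‖vⱼ − vₖ‖²` with `U = (ΣM)⁻¹Σ Mₖvₖ` the REST-MASS
   mean velocity. This is the "`2T`" term of the Lagrange–Jacobi / virial identity for `G = Σⱼ pⱼ·(ξⱼ − X_M)`
   (`X_M` the rest-mass centre, `pⱼ = Mⱼγⱼvⱼ` the kinematic momenta of the identification clause):
   `dG/dt = Σⱼ pⱼ·(vⱼ − U) + Σⱼ ṗⱼ·(ξⱼ − X_M) + o(1)`. It is what makes a virial argument possible WITHOUT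
   energy-weighted centres (whose "sloshing" under internal energy redistribution is not controlled by the window
   law) — see the evidence note `InertialRecession_endgame_generalN.md` on the crux item for the full architecture
   (confined clusters are cold; large scale-`t` splits are irreversible; top-down induction ⇒ every `vⱼ` converges).
3. `dichotomy_of_tendsto_velocity` — if every velocity converges then the PAIRWISE DICHOTOMY of
   `stub_pairwiseDichotomy` holds (different limits ⇒ linear separation by the slaved Cesàro lemma; equal limits ⇒
   locking). So the open stub is EQUIVALENT (given `…StubEndgameClasses.exists_tendsto_velocity_of_dichotomy`) to
   "every `vⱼ` converges", the natural statement for the virial/induction proof.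
-/

noncomputable section

set_option linter.dupNamespace false

open Filter Topology Set

namespace Summit.FinalStateConjecture.FinalStateConjecture.Theorems.SublinearIsFree.Virial

open Literature.Geometry.Lorentzian
open Summit.FinalStateConjecture.FinalStateConjecture.Theorems.SublinearIsFree.Endgame

/-! ### 1. Strong monotonicity of `v ↦ γ(v) v` -/

/-- The Lorentz factor is at least `1` on the open unit ball: `1 ≤ (√(1 − x²))⁻¹` for `x² < 1`. [folklore] -/
theorem one_le_inv_sqrt_one_sub_sq' {x : ℝ} (hx : x ^ 2 < 1) : 1 ≤ (√(1 - x ^ 2))⁻¹ := by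
  have h1 : 0 < 1 - x ^ 2 := by linarith
  have h2 : √(1 - x ^ 2) ≤ 1 := by
    rw [Real.sqrt_le_one]
    nlinarith [sq_nonneg x]
  have h3 : 0 < √(1 - x ^ 2) := Real.sqrt_pos.mpr h1
  exact (one_le_inv₀ h3).mpr h2

/-- The "excess momentum" `x ↦ x((√(1 − x²))⁻¹ − 1)` is monotone on `[0, 1)`. [folklore] -/
theorem excessMomentum_mono {x y : ℝ} (hx : 0 ≤ x) (hxy : x ≤ y) (hy : y < 1) :
    x * ((√(1 - x ^ 2))⁻¹ - 1) ≤ y * ((√(1 - y ^ 2))⁻¹ - 1) := by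
  have hy0 : 0 ≤ y := hx.trans hxy
  have hy2 : y ^ 2 < 1 := by nlinarith
  have hx2 : x ^ 2 < 1 := by nlinarith
  have hpos : 0 < 1 - y ^ 2 := by linarith
  have hsqrt : √(1 - y ^ 2) ≤ √(1 - x ^ 2) := Real.sqrt_le_sqrt (by nlinarith)
  have hinv : (√(1 - x ^ 2))⁻¹ ≤ (√(1 - y ^ 2))⁻¹ :=
    inv_anti₀ (Real.sqrt_pos.mpr hpos) hsqrt
  have ha : 0 ≤ (√(1 - x ^ 2))⁻¹ - 1 := by linarith [one_le_inv_sqrt_one_sub_sq' hx2]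
  exact mul_le_mul hxy (by linarith) ha hy0

/-- **Strong monotonicity of the relativistic momentum map.** For `a, b` in the open unit ball of `E3`,
`‖a − b‖² ≤ ⟨γ(a)a − γ(b)b, a − b⟩` with `γ(v) = (√(1 − ‖v‖²))⁻¹`: the map `v ↦ γ(v)v` (gradient of the uniformly
convex `v ↦ −√(1 − ‖v‖²)`) is strongly monotone with modulus `1`. Elementary proof: write `γ(a)a = a + A a`,
`A = γ(a) − 1 ≥ 0`; then `⟨Aa − Bb, a − b⟩ ≥ A‖a‖² + B‖b‖² − (A + B)‖a‖‖b‖ = (‖a‖ − ‖b‖)(A‖a‖ − B‖b‖) ≥ 0` by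
`excessMomentum_mono`. Binder form of the registered stub `inner_lorentzMomentum_sub_ge`. [folklore] -/
theorem inner_lorentzMomentum_sub_ge' {a b : E3} (ha : ‖a‖ < 1) (hb : ‖b‖ < 1) :
    ‖a - b‖ ^ 2 ≤ inner ℝ ((√(1 - ‖a‖ ^ 2))⁻¹ • a - (√(1 - ‖b‖ ^ 2))⁻¹ • b) (a - b) := by
  set A : ℝ := (√(1 - ‖a‖ ^ 2))⁻¹ - 1 with hA
  set B : ℝ := (√(1 - ‖b‖ ^ 2))⁻¹ - 1 with hB
  have ha2 : ‖a‖ ^ 2 < 1 := by nlinarith [norm_nonneg a]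
  have hb2 : ‖b‖ ^ 2 < 1 := by nlinarith [norm_nonneg b]
  have hA0 : 0 ≤ A := by simp only [hA]; linarith [one_le_inv_sqrt_one_sub_sq' ha2]
  have hB0 : 0 ≤ B := by simp only [hB]; linarith [one_le_inv_sqrt_one_sub_sq' hb2]
  have hdecomp : (√(1 - ‖a‖ ^ 2))⁻¹ • a - (√(1 - ‖b‖ ^ 2))⁻¹ • b = (a - b) + (A • a - B • b) := by
    simp only [hA, hB, sub_smul, one_smul]; abel
  rw [hdecomp, inner_add_left, real_inner_self_eq_norm_sq]
  suffices h : 0 ≤ inner ℝ (A • a - B • b) (a - b) by linarith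
  have hexp : inner ℝ (A • a - B • b) (a - b) = A * ‖a‖ ^ 2 + B * ‖b‖ ^ 2 - (A + B) * inner ℝ a b := by
    rw [inner_sub_left, inner_sub_right, inner_sub_right, real_inner_smul_left, real_inner_smul_left,
      real_inner_smul_left, real_inner_smul_left, real_inner_self_eq_norm_sq, real_inner_self_eq_norm_sq,
      real_inner_comm a b]
    ring
  rw [hexp]
  have hcs : inner ℝ a b ≤ ‖a‖ * ‖b‖ := real_inner_le_norm a b
  have hkey : 0 ≤ (‖a‖ - ‖b‖) * (A * ‖a‖ - B * ‖b‖) := by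
    rcases le_total ‖a‖ ‖b‖ with hab | hab
    · have hm := excessMomentum_mono (norm_nonneg a) hab hb
      have h1 : ‖a‖ - ‖b‖ ≤ 0 := by linarith
      have h2 : A * ‖a‖ - B * ‖b‖ ≤ 0 := by simp only [hA, hB]; linarith
      exact mul_nonneg_of_nonpos_of_nonpos h1 h2
    · have hm := excessMomentum_mono (norm_nonneg b) hab ha
      have h1 : 0 ≤ ‖a‖ - ‖b‖ := by linarith
      have h2 : 0 ≤ A * ‖a‖ - B * ‖b‖ := by simp only [hA, hB]; linarith
      exact mul_nonneg h1 h2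
  nlinarith [mul_nonneg (add_nonneg hA0 hB0) (sub_nonneg.mpr hcs)]

/-! ### 2. The rest-mass virial is coercive -/

/-- **Virial coercivity (double-sum form).** For weights `Mⱼ ≥ 0` and subluminal velocities `vⱼ`, writing
`gⱼ = γ(vⱼ)vⱼ`: `Σⱼₖ MⱼMₖ‖vⱼ − vₖ‖² ≤ 2((Σₖ Mₖ)(Σⱼ Mⱼ⟨gⱼ, vⱼ⟩) − ⟨Σⱼ Mⱼgⱼ, Σₖ Mₖvₖ⟩)`. The right-hand side is
`2Σⱼₖ MⱼMₖ⟨gⱼ, vⱼ − vₖ⟩ = Σⱼₖ MⱼMₖ⟨gⱼ − gₖ, vⱼ − vₖ⟩` (symmetrisation), and each term is bounded below by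
`inner_lorentzMomentum_sub_ge`. [folklore] -/
theorem virial_coercivity {ι : Type*} (s : Finset ι) (M : ι → ℝ) (v : ι → E3)
    (hM : ∀ i ∈ s, 0 ≤ M i) (hv : ∀ i ∈ s, ‖v i‖ < 1) :
    ∑ j ∈ s, ∑ k ∈ s, M j * M k * ‖v j - v k‖ ^ 2 ≤
      2 * ((∑ k ∈ s, M k) * (∑ j ∈ s, M j * inner ℝ ((√(1 - ‖v j‖ ^ 2))⁻¹ • v j) (v j)) -
        inner ℝ (∑ j ∈ s, M j • ((√(1 - ‖v j‖ ^ 2))⁻¹ • v j)) (∑ k ∈ s, M k • v k)) := by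
  classical
  set g : ι → E3 := fun j ↦ (√(1 - ‖v j‖ ^ 2))⁻¹ • v j with hg
  -- the right-hand side as a double sum
  have hR : (∑ k ∈ s, M k) * (∑ j ∈ s, M j * inner ℝ (g j) (v j)) -
      inner ℝ (∑ j ∈ s, M j • g j) (∑ k ∈ s, M k • v k)
      = ∑ j ∈ s, ∑ k ∈ s, M j * M k * inner ℝ (g j) (v j - v k) := by
    rw [sum_inner]
    simp_rw [inner_sum, real_inner_smul_left, real_inner_smul_right, inner_sub_right, mul_sub,
      Finset.sum_sub_distrib]
    congr 1
    · rw [Finset.mul_sum]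
      refine Finset.sum_congr rfl fun j _ ↦ ?_
      rw [Finset.sum_mul]
      refine Finset.sum_congr rfl fun k _ ↦ ?_
      ring
    · refine Finset.sum_congr rfl fun j _ ↦ Finset.sum_congr rfl fun k _ ↦ ?_
      ring
  -- symmetrisation: the same double sum with the roles of `j` and `k` exchanged
  have hS : ∑ j ∈ s, ∑ k ∈ s, M j * M k * inner ℝ (g j) (v j - v k)
      = ∑ j ∈ s, ∑ k ∈ s, M j * M k * inner ℝ (- g k) (v j - v k) := by
    rw [Finset.sum_comm]
    refine Finset.sum_congr rfl fun j _ ↦ Finset.sum_congr rfl fun k _ ↦ ?_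
    rw [inner_neg_left, ← inner_neg_right, neg_sub]
    ring
  have h2S : 2 * ∑ j ∈ s, ∑ k ∈ s, M j * M k * inner ℝ (g j) (v j - v k)
      = ∑ j ∈ s, ∑ k ∈ s, M j * M k * inner ℝ (g j - g k) (v j - v k) := by
    rw [two_mul]
    nth_rewrite 2 [hS]
    rw [← Finset.sum_add_distrib]
    refine Finset.sum_congr rfl fun j _ ↦ ?_
    rw [← Finset.sum_add_distrib]
    refine Finset.sum_congr rfl fun k _ ↦ ?_
    rw [sub_eq_add_neg (g j) (g k), inner_add_left]
    ring
  rw [hR, h2S]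
  refine Finset.sum_le_sum fun j hj ↦ Finset.sum_le_sum fun k hk ↦ ?_
  have hmono := inner_lorentzMomentum_sub_ge' (hv j hj) (hv k hk)
  exact mul_le_mul_of_nonneg_left hmono (mul_nonneg (hM j hj) (hM k hk))

/-- **Virial coercivity (mean-velocity form).** With `U = (ΣM)⁻¹ Σₖ Mₖvₖ` the rest-mass mean velocity and total
mass `ΣM > 0`: `(2ΣM)⁻¹ Σⱼₖ MⱼMₖ‖vⱼ − vₖ‖² ≤ Σⱼ Mⱼ⟨γ(vⱼ)vⱼ, vⱼ − U⟩`. This is the coercive "`2T`" term of the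
relativistic Lagrange–Jacobi identity for `G = Σⱼ Mⱼγⱼvⱼ·(ξⱼ − X_M)` with the REST-MASS centre `X_M`. [folklore] -/
theorem virial_coercivity_mean' {ι : Type*} (s : Finset ι) (M : ι → ℝ) (v : ι → E3)
    (hM : ∀ i ∈ s, 0 ≤ M i) (hv : ∀ i ∈ s, ‖v i‖ < 1) (hpos : 0 < ∑ k ∈ s, M k) :
    (2 * ∑ k ∈ s, M k)⁻¹ * ∑ j ∈ s, ∑ k ∈ s, M j * M k * ‖v j - v k‖ ^ 2 ≤
      ∑ j ∈ s, M j * inner ℝ ((√(1 - ‖v j‖ ^ 2))⁻¹ • v j) (v j - (∑ k ∈ s, M k)⁻¹ • ∑ k ∈ s, M k • v k) := by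
  classical
  set Mt : ℝ := ∑ k ∈ s, M k with hMt
  have hne : Mt ≠ 0 := hpos.ne'
  have hmain := virial_coercivity s M v hM hv
  -- the target's right-hand side is `Mt⁻¹ * (bracket of virial_coercivity)`
  have hrhs : ∑ j ∈ s, M j * inner ℝ ((√(1 - ‖v j‖ ^ 2))⁻¹ • v j) (v j - Mt⁻¹ • ∑ k ∈ s, M k • v k)
      = Mt⁻¹ * ((Mt * ∑ j ∈ s, M j * inner ℝ ((√(1 - ‖v j‖ ^ 2))⁻¹ • v j) (v j)) -
          inner ℝ (∑ j ∈ s, M j • ((√(1 - ‖v j‖ ^ 2))⁻¹ • v j)) (∑ k ∈ s, M k • v k)) := by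
    rw [mul_sub, ← mul_assoc, inv_mul_cancel₀ hne, one_mul, sum_inner, Finset.mul_sum,
      ← Finset.sum_sub_distrib]
    refine Finset.sum_congr rfl fun j _ ↦ ?_
    simp only [inner_sub_right, real_inner_smul_right, real_inner_smul_left]
    ring
  rw [hrhs]
  have hinv : 0 < Mt⁻¹ := inv_pos.mpr hpos
  have h2 : (2 * Mt)⁻¹ * ∑ j ∈ s, ∑ k ∈ s, M j * M k * ‖v j - v k‖ ^ 2
      = Mt⁻¹ * (2⁻¹ * ∑ j ∈ s, ∑ k ∈ s, M j * M k * ‖v j - v k‖ ^ 2) := by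
    rw [mul_inv, ← mul_assoc, mul_comm (2 : ℝ)⁻¹]
  rw [h2]
  refine mul_le_mul_of_nonneg_left ?_ hinv.le
  linarith

/-! ### 3. The pairwise dichotomy from velocity convergence -/

/-- **Velocity convergence ⇒ the pairwise dichotomy.** If the centres `ξᵢ` are differentiable, slaved to the
velocities (`ξ̇ᵢ − vᵢ → 0`), and EVERY velocity converges, then every pair either separates linearly or locks:
different limits `Vⱼ ≠ Vᵢ` give `(ξⱼ − ξᵢ)(t)/t → Vⱼ − Vᵢ`, hence `‖ξⱼ − ξᵢ‖ ≥ ½‖Vⱼ − Vᵢ‖·t` eventually; equal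
limits give `vⱼ − vᵢ → 0`. Consequently `stub_pairwiseDichotomy` (line `sublinear-is-free-clean-window-charges`)
reduces to "every `vⱼ` converges" under its own hypotheses. [folklore] -/
theorem dichotomy_of_tendsto_velocity' {N : ℕ} (ξ v : Fin N → ℝ → E3)
    (hξ : ∀ i, Differentiable ℝ (ξ i))
    (hslave : ∀ i, Tendsto (fun t ↦ deriv (ξ i) t - v i t) atTop (𝓝 0))
    (hconv : ∀ i, ∃ V : E3, Tendsto (v i) atTop (𝓝 V)) (i j : Fin N) :
    (∃ σ : ℝ, 0 < σ ∧ ∀ᶠ t in atTop, σ * t ≤ ‖ξ j t - ξ i t‖) ∨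
      Tendsto (fun t ↦ v j t - v i t) atTop (𝓝 0) := by
  obtain ⟨Vi, hVi⟩ := hconv i
  obtain ⟨Vj, hVj⟩ := hconv j
  by_cases hV : Vj = Vi
  · right
    have := hVj.sub hVi
    rwa [hV, sub_self] at this
  · left
    set W : E3 := Vj - Vi with hW
    have hW0 : 0 < ‖W‖ := norm_pos_iff.mpr (sub_ne_zero.mpr hV)
    -- the difference is slaved to `vⱼ − vᵢ → W`
    have hdiff : Differentiable ℝ (fun t ↦ ξ j t - ξ i t) := (hξ j).sub (hξ i)
    have hderiv : deriv (fun t ↦ ξ j t - ξ i t) = fun t ↦ deriv (ξ j) t - deriv (ξ i) t := by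
      funext t
      exact deriv_sub (hξ j t) (hξ i t)
    have hsl : Tendsto (fun t ↦ deriv (fun t ↦ ξ j t - ξ i t) t - (v j t - v i t)) atTop (𝓝 0) := by
      have := (hslave j).sub (hslave i)
      rw [sub_zero] at this
      rw [hderiv]
      refine this.congr' (Eventually.of_forall fun t ↦ ?_)
      simp only
      abel
    have hces : Tendsto (fun t : ℝ ↦ t⁻¹ • (ξ j t - ξ i t)) atTop (𝓝 W) :=
      tendsto_inv_smul_of_slaved hdiff hsl (hVj.sub hVi)
    have hnorm : Tendsto (fun t : ℝ ↦ ‖t⁻¹ • (ξ j t - ξ i t)‖) atTop (𝓝 ‖W‖) := hces.norm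
    have hev : ∀ᶠ t in atTop, ‖W‖ / 2 < ‖t⁻¹ • (ξ j t - ξ i t)‖ :=
      hnorm.eventually (lt_mem_nhds (by linarith))
    refine ⟨‖W‖ / 2, by linarith, ?_⟩
    filter_upwards [hev, eventually_gt_atTop (0 : ℝ)] with t ht htpos
    rw [norm_smul, norm_inv, Real.norm_eq_abs, abs_of_pos htpos, mul_comm] at ht
    have h1 : ‖W‖ / 2 * t < ‖ξ j t - ξ i t‖ * t⁻¹ * t := mul_lt_mul_of_pos_right ht htpos
    rw [inv_mul_cancel_right₀ htpos.ne'] at h1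
    exact h1.le

/-! ### Registered stubs (one-line signatures, verbatim) -/

/-- Registered stub `inner_lorentzMomentum_sub_ge` (crux `stmt-FinalStateConjecture-10166`): strong monotonicity of
`v ↦ γ(v)v` on the unit ball, one-line form of `inner_lorentzMomentum_sub_ge'`. [folklore] -/
theorem inner_lorentzMomentum_sub_ge : open Literature.Geometry.Lorentzian in ∀ {a b : E3}, ‖a‖ < 1 → ‖b‖ < 1 → ‖a - b‖ ^ 2 ≤ inner ℝ ((√(1 - ‖a‖ ^ 2))⁻¹ • a - (√(1 - ‖b‖ ^ 2))⁻¹ • b) (a - b) :=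
  fun ha hb ↦ inner_lorentzMomentum_sub_ge' ha hb

/-- Registered stub `virial_coercivity_mean` (crux `stmt-FinalStateConjecture-10166`): the rest-mass virial is coercive,
one-line form of `virial_coercivity_mean'`. [folklore] -/
theorem virial_coercivity_mean : open Literature.Geometry.Lorentzian in ∀ {ι : Type*} (s : Finset ι) (M : ι → ℝ) (v : ι → E3), (∀ i ∈ s, 0 ≤ M i) → (∀ i ∈ s, ‖v i‖ < 1) → 0 < ∑ k ∈ s, M k → (2 * ∑ k ∈ s, M k)⁻¹ * ∑ j ∈ s, ∑ k ∈ s, M j * M k * ‖v j - v k‖ ^ 2 ≤ ∑ j ∈ s, M j * inner ℝ ((√(1 - ‖v j‖ ^ 2))⁻¹ • v j) (v j - (∑ k ∈ s, M k)⁻¹ • ∑ k ∈ s, M k • v k) :=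
  fun s M v hM hv hpos ↦ virial_coercivity_mean' s M v hM hv hpos

/-- Registered stub `dichotomy_of_tendsto_velocity` (crux `stmt-FinalStateConjecture-10166`): velocity convergence
implies the pairwise dichotomy, one-line form of `dichotomy_of_tendsto_velocity'`. [folklore] -/
theorem dichotomy_of_tendsto_velocity : open Literature.Geometry.Lorentzian Filter Topology in ∀ {N : ℕ} (ξ v : Fin N → ℝ → E3), (∀ i, Differentiable ℝ (ξ i)) → (∀ i, Tendsto (fun t ↦ deriv (ξ i) t - v i t) atTop (𝓝 0)) → (∀ i, ∃ V : E3, Tendsto (v i) atTop (𝓝 V)) → ∀ (i j : Fin N), (∃ σ : ℝ, 0 < σ ∧ ∀ᶠ t in atTop, σ * t ≤ ‖ξ j t - ξ i t‖) ∨ Tendsto (fun t ↦ v j t - v i t) atTop (𝓝 0) :=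
  fun ξ v hξ hslave hconv i j ↦ dichotomy_of_tendsto_velocity' ξ v hξ hslave hconv i j

end Summit.FinalStateConjecture.FinalStateConjecture.Theorems.SublinearIsFree.Virial

end
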